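import Summits.CriticalPhenomena.PercolationContinuityZ3.Theorems.Transplant.AutChartCriticalContinuity
import HarnessLib

/-!
# The WALL without finite stabilisers, as a Lean hypothesis: modulo the one-type scaled node, Conj. 4 for graphs with a transitive group of
# automorphisms REDUCES to the actions all of whose STABILISER-KILLING character pairs are dependent

builds on p205010 (kernel theorem, internal audit signed; external expert review pending) — nothing in this file uses p205010.  CONDITIONAL on the OPEN
node `SamePDropOfSkeletonFrmScaled₁` (hypothesis `hN`) and on the explicit WALL hypothesis `hwall`; nothing is claimed about either.  Lane `prim-bschramm`,
seat `prim-bschramm-p4` gen 25 (PART C3 of `P4-GENERAL.md` §47.11).  Helper file (`--supports stmt-CriticalPhenomena-4575 --as helper`).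

Gen 22's `Wall.conj4_transitive_of_frmScaledNode₁_of_wall` stated the residual for FINITE-stabiliser actions (all character pairs dependent).  With gen 25's
`AutChart.criticalContinuity` the finiteness is gone and the residual sharpens accordingly: **`Wall.conj4_autChart_of_frmScaledNode₁_of_wall`** — `U_s` +
[Conj. 4 for connected locally finite graphs with a transitive action by automorphisms, ARBITRARY stabilisers, all of whose pairs of characters KILLING THE
STABILISER are dependent] ⟹ Conj. 4 (`p_c < 1 ⟹ θ_v(p_c) = 0`) for EVERY connected locally finite graph with a transitive action by automorphisms.  The wall
is thus exactly: "every transitive `A ≤ Sym(V)` by automorphisms has `b₁(A rel Stab) ≤ 1`" — the multi-type / quasi-step node of the planners (P4 §41.5, §47.8).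
[cite: BenjaminiSchramm1996, Conj. 4; §2 (almost transitive graphs)] [cite: MilnorSolvableGrowth1968, Lemma 1]
-/

noncomputable section

namespace Summit.CriticalPhenomena.PercolationContinuityZ3.Theorems.Transplant
open SimpleGraph Literature.Probability.LatticeModels Literature.Probability.Percolation
open scoped Classical

namespace Wall

/-- **REDUCTION (transitive actions, ARBITRARY stabilisers): modulo the scaled node, Conjecture 4 for all connected locally finite graphs with a transitive
group of automorphisms follows from its WALL case — the actions whose stabiliser-killing characters are pairwise dependent.**  The complement is gen 25's
`AutChart.criticalContinuity`.  CONDITIONAL on `U_s` (`hN`) and on the wall hypothesis (`hwall`). [cite: BenjaminiSchramm1996, Conj. 4; §2] -/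
theorem conj4_autChart_of_frmScaledNode₁_of_wall (hN : SamePDropOfSkeletonFrmScaled₁)
    (hwall : ∀ {V : Type} {G : SimpleGraph V} [G.LocallyFinite] {A : Type} [Group A] [MulAction A V],
      IsActionByAut G A → G.Connected → ∀ t : V, (∀ v : V, ∃ a : A, a • t = v) →
      (∀ (ψ₀ ψ₁ : A →* Multiplicative ℤ), (∀ h ∈ MulAction.stabilizer A t, ψ₀ h = 1) → (∀ h ∈ MulAction.stabilizer A t, ψ₁ h = 1) →
        ∀ a b : A, Multiplicative.toAdd (ψ₀ a) * Multiplicative.toAdd (ψ₁ b) = Multiplicative.toAdd (ψ₁ a) * Multiplicative.toAdd (ψ₀ b)) →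
      ∀ v : V, criticalProb G v < 1 → theta G v (criticalProbIOf G v) = 0)
    {V : Type} {G : SimpleGraph V} [G.LocallyFinite] {A : Type} [Group A] [MulAction A V] (hact : IsActionByAut G A) (hc : G.Connected)
    (t : V) (htr : ∀ v : V, ∃ a : A, a • t = v) (v : V) (hpc : criticalProb G v < 1) : theta G v (criticalProbIOf G v) = 0 := by
  by_cases hind : ∃ (ψ₀ ψ₁ : A →* Multiplicative ℤ), (∀ h ∈ MulAction.stabilizer A t, ψ₀ h = 1) ∧ (∀ h ∈ MulAction.stabilizer A t, ψ₁ h = 1) ∧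
      ∃ a b : A, Multiplicative.toAdd (ψ₀ a) * Multiplicative.toAdd (ψ₁ b) ≠ Multiplicative.toAdd (ψ₁ a) * Multiplicative.toAdd (ψ₀ b)
  · obtain ⟨ψ₀, ψ₁, h₀, h₁, a, b, hne⟩ := hind
    refine AutChart.criticalContinuity hN hact hc t htr (CayleyScaled.pairHom ψ₀ ψ₁) (fun h hh => ?_)
      ⟨a, b, by rw [MaxArea.det2, CayleyScaled.toAdd_pairHom_zero, CayleyScaled.toAdd_pairHom_one, CayleyScaled.toAdd_pairHom_zero,
        CayleyScaled.toAdd_pairHom_one]; exact sub_ne_zero.2 hne⟩ v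
    rw [← ofAdd_toAdd (CayleyScaled.pairHom ψ₀ ψ₁ h), ← ofAdd_zero]
    congr 1
    funext i
    fin_cases i
    · show Multiplicative.toAdd (CayleyScaled.pairHom ψ₀ ψ₁ h) 0 = 0
      rw [CayleyScaled.toAdd_pairHom_zero, h₀ h hh, toAdd_one]
    · show Multiplicative.toAdd (CayleyScaled.pairHom ψ₀ ψ₁ h) 1 = 0
      rw [CayleyScaled.toAdd_pairHom_one, h₁ h hh, toAdd_one]
  · push Not at hind
    exact hwall hact hc t htr (fun ψ₀ ψ₁ h₀ h₁ a b => hind ψ₀ ψ₁ h₀ h₁ a b) v hpc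

/-- **The scaled node ALONE settles Conj. 4 off the wall, unconditionally non-vacuously**: for a transitive action with two independent stabiliser-killing
characters, `p_c < 1` holds outright (`AutChart.criticalProb_lt_one`) and `θ_v(p_c) = 0` modulo `U_s` — the Conj.-4-shaped statement of the complement of
the wall. [cite: BenjaminiSchramm1996, Conj. 4] -/
theorem conj4_off_wall (hN : SamePDropOfSkeletonFrmScaled₁) {V : Type} {G : SimpleGraph V} [G.LocallyFinite] {A : Type} [Group A] [MulAction A V]
    (hact : IsActionByAut G A) (hc : G.Connected) (t : V) (htr : ∀ v : V, ∃ a : A, a • t = v) (ψ₀ ψ₁ : A →* Multiplicative ℤ)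
    (h₀ : ∀ h ∈ MulAction.stabilizer A t, ψ₀ h = 1) (h₁ : ∀ h ∈ MulAction.stabilizer A t, ψ₁ h = 1) (a b : A)
    (hne : Multiplicative.toAdd (ψ₀ a) * Multiplicative.toAdd (ψ₁ b) ≠ Multiplicative.toAdd (ψ₁ a) * Multiplicative.toAdd (ψ₀ b)) (v : V) :
    criticalProb G v < 1 ∧ theta G v (criticalProbIOf G v) = 0 := by
  have hstab : ∀ h ∈ MulAction.stabilizer A t, CayleyScaled.pairHom ψ₀ ψ₁ h = 1 := by
    intro h hh
    rw [← ofAdd_toAdd (CayleyScaled.pairHom ψ₀ ψ₁ h), ← ofAdd_zero]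
    congr 1
    funext i
    fin_cases i
    · show Multiplicative.toAdd (CayleyScaled.pairHom ψ₀ ψ₁ h) 0 = 0
      rw [CayleyScaled.toAdd_pairHom_zero, h₀ h hh, toAdd_one]
    · show Multiplicative.toAdd (CayleyScaled.pairHom ψ₀ ψ₁ h) 1 = 0
      rw [CayleyScaled.toAdd_pairHom_one, h₁ h hh, toAdd_one]
  have hrank : ∃ a b : A, MaxArea.det2 (Multiplicative.toAdd (CayleyScaled.pairHom ψ₀ ψ₁ a)) (Multiplicative.toAdd (CayleyScaled.pairHom ψ₀ ψ₁ b)) ≠ 0 :=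
    ⟨a, b, by rw [MaxArea.det2, CayleyScaled.toAdd_pairHom_zero, CayleyScaled.toAdd_pairHom_one, CayleyScaled.toAdd_pairHom_zero,
      CayleyScaled.toAdd_pairHom_one]; exact sub_ne_zero.2 hne⟩
  exact AutChart.conj4 hN hact hc t htr (CayleyScaled.pairHom ψ₀ ψ₁) hstab hrank v

end Wall

end Summit.CriticalPhenomena.PercolationContinuityZ3.Theorems.Transplant
end
-- build-touch 2026-08-25T10:15:28Z T1-B (lead g18, cohort named in T1-C): re-land of p395857, declarations byte-identical
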